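import Summits.ResolutionOfSingularities.ResolutionOfSingularities.Theorems.PurelyInseparableDim4ChartCentreClosed
import Mathlib.AlgebraicGeometry.ValuativeCriterion
import Mathlib.RingTheory.LaurentSeries
import HarnessLib

/-!
# Purely inseparable four-folds `z^p + F(x₁, …, x₄)`: CENTRE ESCAPE — the walk's next coordinate centre read
# on a chart is NOT closed in the blown-up ambient unless it contains every old fibre direction
# (brick TY-2 (h) part 5 of cell `res-dim4-pi`: the converse of the closedness criterion)

[OURS · counted 0] (D-0157 DOOR 2; director-resolution DR-157-C; frame `PIDim4.TerminationImpliesOrderReduction`,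
S3 (c); frame-caveat candidate FC-2 «centre escape» of typ-2 g2's bus note 20:23:59Z). Setting of
`PurelyInseparableDim4ChartCentreClosed.lean`: `π : W → 𝔸⁵_K` ANY blowing up along `V(z, x_S)`, `j ∈ S`, a
re-centring automorphism `Θ` of `K[z, x]` (`Θ z = z + h(x)`, `Θ xᵢ = xᵢ + bᵢ`, `b_j = 0`) and the re-centred
`x_j`-chart `φ = Spec Θ ≫ chartImm : 𝔸⁵_K ⟶ W`. That file proved: `S.erase j ⊆ S'` ⇒ `φ(V(z, x_{S'}))` is CLOSED
in `W`. PROVED here (no `sorry`, no new axiom): the CONVERSE —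

* **`not_isClosed_image_CΛ_chart`** — if some `i ∈ S`, `i ≠ j`, is NOT in `S'`, then `φ(V(z, x_{S'}))` is NOT
  closed in `W`;
* **`isClosed_image_CΛ_chart_iff`** — hence `φ(V(z, x_{S'}))` is closed in `W` iff `S.erase j ⊆ S'`.

Mechanism (valuative criterion of properness, Mathlib `UniversallyClosed.eq_valuativeCriterion`): with
`R = K⟦t⟧ ⊂ L = K((t))`, the `L`-point `xᵢ = t⁻¹`, all other coordinates `0`, of the chart lies on `V(z, x_{S'})`
(`i ∉ S'`) and maps under `φ ≫ π` to the CONSTANT point `(z, x) = (0, b|_{off S})` of the centre — on the `x_j`-chart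
`xᵢ` (`i ∈ S ∖ j`) is a fibre coordinate (`ψ(xᵢ) = x_j xᵢ`) and `x_j ↦ 0`. Properness of `π` lifts the constant
`R`-point to `ℓ : Spec R → W` through this `L`-point; were `φ(V(z, x_{S'}))` closed, the closed point of `Spec R`
would land in it (it specialises from the generic point), hence `ℓ` would factor through the chart `𝔸⁵_K`
and `t⁻¹ = ℓ^*(xᵢ)` would lie in `K⟦t⟧` — absurd. So the walk's MODE-1h choice of a LARGE next centre
(small `S'`) at a point of a chart of a blow-up with `|S| ≥ 2` has, in general, NO verbatim global counterpart
in `W` (its closure leaves the chart); the frame's `Terminates1h ⇒ OrderReduction` is a patching statement there,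
not bookkeeping. Nothing here is a statement about resolution of singularities in dimension ≥ 4 /
characteristic `p` (NOT proved anywhere in this programme). bears_on: LADDER-RESOLUTION:D157-DOOR2 (res-dim4-pi).
Supports stmt-ResolutionOfSingularities-16155 (helper, TY-2 (h)).
-/

-- every declaration of this summit lives under `Summit.ResolutionOfSingularities.ResolutionOfSingularities`
-- (summit = problem), which the duplicate-namespace linter flags; house convention (cf. the Target file).
set_option linter.dupNamespace false

noncomputable section

open MvPolynomial Finset CategoryTheory AlgebraicGeometry Opposite TopologicalSpace
open AlgebraicGeometry.Scheme.IdealSheafData (ofIdealTop vanishingIdeal)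
open scoped PowerSeries LaurentSeries

namespace Summit.ResolutionOfSingularities.ResolutionOfSingularities.Theorems.PIDim4

open Literature.AlgebraicGeometry.Resolution
open Literature.AlgebraicGeometry.Resolution.AffinePointBlowup (P A γ coord Wtop)

namespace ChartDictionary

section Escape

variable {K : Type} [Field K] {S S' : Finset (Fin 4)} {i j : Fin 4} {b : Fin 4 → K}
  {Θ : A 4 K ≃ₐ[K] A 4 K} {h : MvPolynomial (Fin 4) K} {W : Scheme.{0}} {π : W ⟶ P 4 K}

/-- In a domain, a nonzero NON-UNIT `t` has no inverse in the ring: `t⁻¹ ∈ L` is not in the image of `R`. -/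
theorem inv_not_mem_range_algebraMap {R L : Type*} [CommRing R] [IsDomain R] [Field L] [Algebra R L]
    [IsFractionRing R L] {t : R} (ht : t ≠ 0) (hu : ¬ IsUnit t) :
    (algebraMap R L t)⁻¹ ∉ Set.range (algebraMap R L) := by
  rintro ⟨r, hr⟩
  apply hu
  have htL : algebraMap R L t ≠ 0 := fun h0 => ht ((map_eq_zero_iff _ (IsFractionRing.injective R L)).mp h0)
  have h1 : algebraMap R L (t * r) = algebraMap R L 1 := by
    rw [map_mul, hr, mul_inv_cancel₀ htL, map_one]
  exact IsUnit.of_mul_eq_one r (IsFractionRing.injective R L h1)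

/-- **The escaping `L`-point.** For `i ∈ S ∖ {j}` with `i ∉ S'`, `R` a `K`-algebra domain with fraction field `L`
and `u ∈ L`: the `L`-point `xᵢ = u`, all other coordinates `0`, of `𝔸⁵` lies on `V(z, x_{S'})`, and along
`Θ ∘ ψ` (`ψ` the `x_j`-chart substitution, `Θ xₖ = xₖ + bₖ`, `Θ z = z + h`, `b_j = 0`) every coordinate function
of the base takes a CONSTANT value: `z, x_S ↦ 0`, `xₖ ↦ bₖ` (`k ∉ S`). -/
theorem eval_clean_subst_X (hj : j ∈ S) (hiS : i ∈ S) (hij : i ≠ j) (hbj : b j = 0)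
    (hs : ∀ k : Fin 4, Θ (X k.succ) = X k.succ + C (b k))
    {R L : Type} [CommRing R] [CommRing L] [Algebra K R] (f : R →+* L) (u : L) (k : Fin (4 + 1)) :
    MvPolynomial.eval₂Hom (f.comp (algebraMap K R))
        (fun l : Fin (4 + 1) => if l = i.succ then u else 0)
        ((Θ : A 4 K →+* A 4 K) (coordBlowupSubst K (insert 0 (Fin.succ '' (S : Set (Fin 4)))) j.succ (X k))) =
      f (Fin.cases (0 : R) (fun l => if l ∈ S then 0 else algebraMap K R (b l)) k) := by
  have hji : (j.succ : Fin (4 + 1)) ≠ i.succ := fun e => hij (Fin.succ_inj.mp e).symm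
  have hΘj : (Θ : A 4 K →+* A 4 K) (X j.succ) = X j.succ := by
    rw [show (Θ : A 4 K →+* A 4 K) (X j.succ) = Θ (X j.succ) from rfl, hs j, hbj, C_0, add_zero]
  have hej : MvPolynomial.eval₂Hom (f.comp (algebraMap K R)) (fun l : Fin (4 + 1) => if l = i.succ then u else 0)
      (X j.succ : A 4 K) = 0 := by
    rw [eval₂Hom_X', if_neg hji]
  refine Fin.cases ?_ (fun l => ?_) k
  · -- `z ↦ x_j (z + h) ↦ 0`
    rw [coordBlowupSubst_centreVars_X_zero, map_mul, hΘj, map_mul, hej, zero_mul, Fin.cases_zero, map_zero]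
  · rw [Fin.cases_succ]
    by_cases hl : l ∈ S
    · rw [if_pos hl, map_zero]
      by_cases hlj : l = j
      · subst hlj
        rw [coordBlowupSubst_X_self, hΘj, hej]
      · rw [coordBlowupSubst_X_of_mem_of_ne K _ j.succ (succ_mem_centreVars hl)
          (fun e => hlj (Fin.succ_inj.mp e)), map_mul, hΘj, map_mul, hej, zero_mul]
    · have hli : (l.succ : Fin (4 + 1)) ≠ i.succ := fun e => hl ((Fin.succ_inj.mp e) ▸ hiS)
      rw [if_neg hl, coordBlowupSubst_X_of_not_mem K _ j.succ (fun hm => hl ((succ_mem_centreVars_iff S l).mp hm)),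
        show (Θ : A 4 K →+* A 4 K) (X l.succ) = Θ (X l.succ) from rfl, hs l, map_add, eval₂Hom_X', if_neg hli,
        zero_add, eval₂Hom_C, RingHom.comp_apply]

/-- **CENTRE ESCAPE.** Let `π : W → 𝔸⁵_K` be any blowing up along `V(z, x_S)`, `j ∈ S`, `Θ` a re-centring automorphism
(`Θ z = z + h(x)`, `Θ xᵢ = xᵢ + bᵢ`, `b_j = 0`), and suppose some old centre variable `xᵢ`, `i ∈ S ∖ {j}`, is NOT
among the variables of the next centre (`i ∉ S'`). Then the image of `V(z, x_{S'})` under the re-centred chart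
`Spec Θ ≫ chartImm : 𝔸⁵_K ⟶ W` is NOT closed in `W`: the fibre coordinate `xᵢ` runs off to the hyperplane at
infinity of the exceptional fibre (valuative criterion for the proper `π`, with `R = K⟦t⟧`, `xᵢ = t⁻¹`). -/
theorem not_isClosed_image_CΛ_chart (hj : j ∈ S) (hbj : b j = 0)
    (hs : ∀ k : Fin 4, Θ (X k.succ) = X k.succ + C (b k))
    (hπ : IsBlowup π (AffineCoordBlowup.𝓘Λ 4 K (insert 0 (Fin.succ '' (S : Set (Fin 4))))))
    (hiS : i ∈ S) (hij : i ≠ j) (hiS' : i ∉ S') :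
    ¬ IsClosed ((Spec.map (CommRingCat.ofHom (Θ : A 4 K →+* A 4 K)) ≫
        AffineCoordBlowup.chartImm hπ (succ_mem_centreVars hj)) ''
      (AffineCoordBlowup.CΛ 4 K (insert 0 (Fin.succ '' (S' : Set (Fin 4)))) : Set (P 4 K))) := by
  intro hT
  haveI : IsIso (CommRingCat.ofHom (Θ : A 4 K →+* A 4 K)) :=
    (inferInstance : IsIso Θ.toRingEquiv.toCommRingCatIso.hom)
  haveI : IsProper π := hπ.isProper
  -- the valuation ring `R = K⟦t⟧`, its fraction field `L = K((t))`, and the two points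
  set R : Type := K⟦X⟧ with hR
  set L : Type := K⸨X⸩ with hL
  set v : Fin (4 + 1) → L := fun l => if l = i.succ then (algebraMap R L PowerSeries.X)⁻¹ else 0 with hv
  set eL : A 4 K →+* L := MvPolynomial.eval₂Hom ((algebraMap R L).comp (algebraMap K R)) v with heL
  set c : Fin (4 + 1) → R := Fin.cases (0 : R) (fun l => if l ∈ S then 0 else algebraMap K R (b l)) with hc
  set eR : A 4 K →+* R := MvPolynomial.eval₂Hom (algebraMap K R) c with heR
  set φ := Spec.map (CommRingCat.ofHom (Θ : A 4 K →+* A 4 K)) ≫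
    AffineCoordBlowup.chartImm hπ (succ_mem_centreVars hj) with hφ
  -- the square `Spec L → W`, `Spec R → 𝔸⁵` commutes
  have hring : eL.comp ((Θ : A 4 K →+* A 4 K).comp
      (coordBlowupSubst K (insert 0 (Fin.succ '' (S : Set (Fin 4)))) j.succ).toRingHom) =
      (algebraMap R L).comp eR := by
    have hΘC : ∀ r : K, (Θ : A 4 K →+* A 4 K) (C r) = C r := fun r => Θ.commutes r
    refine MvPolynomial.ringHom_ext (fun r => ?_) (fun k => ?_)
    · simp only [RingHom.comp_apply, AlgHom.toRingHom_eq_coe, AlgHom.coe_toRingHom, coordBlowupSubst_C, hΘC, heL,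
        heR, eval₂Hom_C]
    · rw [RingHom.comp_apply, RingHom.comp_apply, AlgHom.toRingHom_eq_coe, AlgHom.coe_toRingHom,
        eval_clean_subst_X hj hiS hij hbj hs (algebraMap R L) _ k, RingHom.comp_apply, heR, eval₂Hom_X']
  have hsq : CommSq (Spec.map (CommRingCat.ofHom eL) ≫ φ)
      (Spec.map (CommRingCat.ofHom (algebraMap R L))) π (Spec.map (CommRingCat.ofHom eR)) := by
    refine ⟨?_⟩
    rw [hφ, Category.assoc, Category.assoc, AffineCoordBlowup.chartImm_comp hπ (succ_mem_centreVars hj),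
      ← Spec.map_comp, ← Spec.map_comp, ← Spec.map_comp]
    congr 1
    ext1
    simpa only [CommRingCat.hom_comp, CommRingCat.hom_ofHom] using hring
  let sq : ValuativeCommSq π :=
    { R := R, K := L, i₁ := Spec.map (CommRingCat.ofHom eL) ≫ φ, i₂ := Spec.map (CommRingCat.ofHom eR), commSq := hsq }
  -- properness of `π`: the square has a lift `ℓ : Spec R → W`
  have hex : ValuativeCriterion.Existence π := by
    have hp : (ValuativeCriterion.Existence ⊓ @QuasiCompact) π := by
      rw [← UniversallyClosed.eq_valuativeCriterion]
      infer_instance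
    exact hp.1
  obtain ⟨⟨ℓ, hℓ₁, hℓ₂⟩⟩ := (hex sq).exists_lift
  -- the `L`-point lies on `V(z, x_{S'})`, so its image lies in `T`
  have hyL : (Spec.map (CommRingCat.ofHom eL)) default ∈
      (AffineCoordBlowup.CΛ 4 K (insert 0 (Fin.succ '' (S' : Set (Fin 4)))) : Set (P 4 K)) := by
    rw [SetLike.mem_coe, AffineCoordBlowup.mem_CΛ_iff']
    intro l hl
    rw [Spec.map_apply, PrimeSpectrum.comap_asIdeal, Ideal.mem_comap, CommRingCat.hom_ofHom]
    have hv0 : eL (X l) = 0 := by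
      rw [heL, eval₂Hom_X', hv]
      simp only
      rw [if_neg]
      rintro rfl
      rcases hl with hl | ⟨l', hl', hl'e⟩
      · exact Fin.succ_ne_zero i hl
      · exact hiS' ((Fin.succ_inj.mp hl'e) ▸ hl')
    rw [hv0]
    exact Ideal.zero_mem _
  have hgen : ℓ ((Spec.map (CommRingCat.ofHom (algebraMap R L))) default) ∈
      φ '' (AffineCoordBlowup.CΛ 4 K (insert 0 (Fin.succ '' (S' : Set (Fin 4)))) : Set (P 4 K)) := by
    rw [← Scheme.Hom.comp_apply, hℓ₁, Scheme.Hom.comp_apply]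
    exact ⟨_, hyL, rfl⟩
  -- the closed point of `Spec R` specialises from it, so lands in the CLOSED set `T`, inside the chart
  have hclosed : ℓ (IsLocalRing.closedPoint R) ∈
      φ '' (AffineCoordBlowup.CΛ 4 K (insert 0 (Fin.succ '' (S' : Set (Fin 4)))) : Set (P 4 K)) :=
    ((IsLocalRing.specializes_closedPoint _).map ℓ.continuous).mem_closed hT hgen
  have hrange : Set.range ℓ ⊆ Set.range φ := by
    intro w ⟨q, hq⟩
    subst hq
    obtain ⟨y, -, hy⟩ := hclosed
    exact ((IsLocalRing.specializes_closedPoint q).map ℓ.continuous).mem_open φ.isOpenEmbedding.isOpen_range ⟨y, hy⟩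
  -- hence `ℓ` factors through the chart `𝔸⁵`: `ℓ = Spec g ≫ φ`
  set ℓ' := IsOpenImmersion.lift φ ℓ hrange with hℓ'
  have hfac : Spec.map (CommRingCat.ofHom (algebraMap R L)) ≫ ℓ' = Spec.map (CommRingCat.ofHom eL) := by
    rw [← cancel_mono φ, Category.assoc, hℓ', IsOpenImmersion.lift_fac, hℓ₁]
  have hg : Spec.preimage ℓ' ≫ CommRingCat.ofHom (algebraMap R L) = CommRingCat.ofHom eL := by
    apply Spec.map_injective
    rw [Spec.map_comp, Spec.map_preimage, hfac]
  -- and `t⁻¹ = eL(xᵢ)` would lie in `K⟦t⟧`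
  have hi : algebraMap R L ((Spec.preimage ℓ').hom (X i.succ)) = (algebraMap R L PowerSeries.X)⁻¹ := by
    have h1 := congrArg (fun f : CommRingCat.of (A 4 K) ⟶ CommRingCat.of L => f.hom (X i.succ)) hg
    simp only [CommRingCat.hom_comp, CommRingCat.hom_ofHom, RingHom.comp_apply] at h1
    rw [h1, heL, eval₂Hom_X', hv]
    simp only [if_true]
  exact inv_not_mem_range_algebraMap (PowerSeries.X_ne_zero (R := K))
    (fun hu => by simpa [PowerSeries.constantCoeff_X] using PowerSeries.isUnit_iff_constantCoeff.mp hu)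
    ⟨_, hi⟩

/-- **THE CLOSEDNESS CRITERION (iff).** After a blowing up `π : W → 𝔸⁵_K` along `V(z, x_S)`, on the re-centred
`x_j`-chart `Spec Θ ≫ chartImm` (`Θ z = z + h(x)`, `Θ xᵢ = xᵢ + bᵢ`, `b_j = 0`): the walk's next coordinate centre
`V(z, x_{S'})` has CLOSED image in `W` iff `S ∖ {j} ⊆ S'`. -/
theorem isClosed_image_CΛ_chart_iff (hj : j ∈ S) (hbj : b j = 0)
    (h0 : Θ (X 0) = X 0 + rename Fin.succ h) (hs : ∀ k : Fin 4, Θ (X k.succ) = X k.succ + C (b k))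
    (hπ : IsBlowup π (AffineCoordBlowup.𝓘Λ 4 K (insert 0 (Fin.succ '' (S : Set (Fin 4)))))) :
    IsClosed ((Spec.map (CommRingCat.ofHom (Θ : A 4 K →+* A 4 K)) ≫
        AffineCoordBlowup.chartImm hπ (succ_mem_centreVars hj)) ''
      (AffineCoordBlowup.CΛ 4 K (insert 0 (Fin.succ '' (S' : Set (Fin 4)))) : Set (P 4 K))) ↔ S.erase j ⊆ S' := by
  refine ⟨fun hT => ?_, isClosed_image_CΛ_chart hj hbj h0 hs hπ⟩
  intro i hi
  obtain ⟨hij, hiS⟩ := Finset.mem_erase.mp hi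
  by_contra hiS'
  exact not_isClosed_image_CΛ_chart hj hbj hs hπ hiS hij hiS' hT

end Escape

end ChartDictionary

end Summit.ResolutionOfSingularities.ResolutionOfSingularities.Theorems.PIDim4

end
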